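import Literature.Probability.RandomPlanarGeometry.TwoSidedWholePlaneSLEProofs
import HarnessLib

/-!
# Two-sided whole-plane SLE_κ: the Minkowski content parametrisation rooted at `0` — existence layer

Topic `Probability/RandomPlanarGeometry`; theorems only, companion of `TwoSidedWholePlaneSLE` /
`TwoSidedWholePlaneSLEProofs`, towards the named fact `IsTwoSidedWholePlaneSLENatLaw.exists`
(Zhan (2021), §2.2, Lemma 2.12, Thm 4.1 (iv), Cor. 4.7).

The existence fact is NOT discharged here. Any proof of it needs four inputs the tree does not (yet)
prove: the existence of the first arm (`IsWholePlaneSLEKappaRho.exists`, Miller–Sheffield (2017),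
Prop. 2.1 / 2.5, Lawler (2005), Prop. 4.21) and its transience (Miller–Sheffield (2017), Thm 1.12 —
forced by the clause `γ̂|(-∞,0) = η₁ ∘ e'`, `γ̂` continuous at `0`), a measurably chosen prime-end
normalised uniformizer of the remaining domain (`IsArmUniformizer`), and the Minkowski content of the
two-sided curve (Lawler–Rezaei (2015), Thm 1.1; Zhan (2021), Lemmas 2.6–2.12, Thm 4.1 (iv)); the
chordal trace is the tree's `hasSLETrace_of_ne_eight_holds`.

What is proved is the deterministic LAST step of that proof — Zhan (2021), Rem. 2.4 ("Suppose a
parametrizable measure `μ` for `γ` exists. Then we may reparametrize `γ` such that for any `a ≤ b` in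
the definition domain, `μ(γ([a, b])) = b - a`") for a two-sided curve whose content parametrisation
has definition interval `ℝ` (the space `Γ` of Cor. 4.7), rooted at the junction of the arms as in the
almost-sure clauses of `IsTwoSidedWholePlaneSLENatLaw`:

* `hasMinkowskiContent_arc_of_contentMeasure` — Zhan's Def. 2.1 (a Minkowski content measure `M`
  on the trace: `Cont(K ∩ S) = M(K)` for compact `K`) and Def. 2.3 (a time change `θ` with
  `θ(b) - θ(a) = M(γ₀[a, b])`) give the hypothesis used below:
  `Cont_d(γ₀[a, b]) = θ(b) - θ(a)` for all `a ≤ b`.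
* `exists_natParam_of_timeChange` — Rem. 2.4 with prescribed time origin: if
  `Cont_d(γ₀[a, b]) = θ(b) - θ(a)` for a strictly increasing surjective `θ : ℝ → ℝ`, then for every
  `u₀` there is an increasing time change `τ : ℝ ≃o ℝ` with `τ 0 = u₀` such that `γ₀ ∘ τ` is
  parametrised by `d`-dimensional Minkowski content (`IsNaturallyParametrized`).
* `exists_twoSidedConcat` — the two arms `η₁ : ℝ → ℂ` (from `∞` to the tip, tip `= lim_{+∞} η₁`)
  and `η₂ : ℝ≥0 → ℂ` (from the tip on) concatenate to ONE continuous two-sided curve `γ₀ : ℝ → ℂ`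
  with `γ₀|[0,∞) = η₂` and `γ₀|(-∞,0) = η₁ ∘ φ₁` for an order isomorphism `φ₁ : (-∞, 0) ≃o ℝ`, of
  trace `η₁(ℝ) ∪ η₂(ℝ≥0)`.
* `exists_natParam_of_arms` — consequently a two-sided curve through the arms whose Minkowski
  content parametrisation is defined on all of `ℝ` admits a natural parametrisation `γ̂ : C(ℝ, ℂ)`
  rooted at `γ̂(0) = η₂(0)` (`= 0` for the SLE arms) tracing `η₂` on `[0, ∞)` and `η₁` on `(-∞, 0)`
  through increasing time changes — literally the almost-sure clauses of
  `IsTwoSidedWholePlaneSLENatLaw` (whose uniqueness counterpart is `IsNaturallyParametrized.eq_of_arms`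
  in `TwoSidedWholePlaneSLEProofs`).
* (first step of the same proof) `IsWholePlaneSLEKappaRho.comp_of_map_eq`, `…comp_fst` — the
  first arm, a whole-plane SLE_κ(ρ) curve on `(Ω, P)`, transports along measure-transporting maps,
  in particular to a product space `(Ω × Ω', P ⊗ Q)` carrying an independent second coordinate
  (the Brownian path driving the second arm; independence is Mathlib's `indepFun_prod`).

## References

* D. Zhan, *SLE loop measures*, PTRF 179 (2021), arXiv:1702.08026 (arXiv numbering): §2.3
  Def. 2.1, Def. 2.3, Rem. 2.4; Lemma 2.12; Thm 4.1 (iv); Cor. 4.7 and the space `Γ` following it.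
  [Zhan2021SLELoopMeasures]
* G. F. Lawler, M. A. Rezaei, *Minkowski content and natural parameterization for the
  Schramm–Loewner evolution*, Ann. Probab. 43 (2015), Thm 1.1. [LawlerRezaei2015]
-/

noncomputable section

open Set Filter Topology MeasureTheory ProbabilityTheory
open scoped NNReal ENNReal

namespace Literature.Probability.RandomPlanarGeometry

section ContentMeasure

/-- **From a Minkowski content measure to the content of arcs** (Zhan (2021), Def. 2.1 and Def. 2.3):
if `M` is a `d`-dimensional Minkowski content measure on a set `S ⊇ γ₀(ℝ)` in `ℂ` — `Cont_d(K ∩ S) = M(K)`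
for every compact `K` — and the time change `θ` satisfies `M(γ₀[a, b]) = θ(b) - θ(a)`, then every arc
`γ₀[a, b]` of the continuous curve `γ₀` has `d`-dimensional Minkowski content `θ(b) - θ(a)`.
[cite: Zhan2021SLELoopMeasures, Def. 2.1 / Def. 2.3] -/
theorem hasMinkowskiContent_arc_of_contentMeasure {d : ℝ} {γ₀ : ℝ → ℂ} (hγ₀ : Continuous γ₀)
    {S : Set ℂ} (hS : range γ₀ ⊆ S) (M : Measure ℂ)
    (hM : ∀ K, IsCompact K → HasMinkowskiContent d (K ∩ S) (M K))
    {θ : ℝ → ℝ} (hθ : ∀ a b, a ≤ b → M (γ₀ '' Icc a b) = ENNReal.ofReal (θ b - θ a))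
    {a b : ℝ} (hab : a ≤ b) :
    HasMinkowskiContent d (γ₀ '' Icc a b) (ENNReal.ofReal (θ b - θ a)) := by
  have h := hM (γ₀ '' Icc a b) (isCompact_Icc.image hγ₀)
  rwa [inter_eq_left.2 ((image_subset_range _ _).trans hS), hθ a b hab] at h

end ContentMeasure

section TimeChange

/-- **Reparametrisation by Minkowski content with prescribed time origin** (Zhan (2021), Rem. 2.4,
for a content parametrisation with definition interval `ℝ`): if the arcs of `γ₀ : ℝ → ℂ` have
`d`-dimensional Minkowski content `Cont_d(γ₀[a, b]) = θ(b) - θ(a)` for a strictly increasing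
surjective time change `θ : ℝ → ℝ`, then for every `u₀ ∈ ℝ` the increasing time change
`τ = θ⁻¹(· + θ(u₀)) : ℝ ≃o ℝ` has `τ(0) = u₀` and `γ₀ ∘ τ` is parametrised by `d`-dimensional Minkowski
content (`Cont_d((γ₀ ∘ τ)[a, b]) = b - a`) and continuous when `γ₀` is.
[cite: Zhan2021SLELoopMeasures, Rem. 2.4] -/
theorem exists_natParam_of_timeChange {d : ℝ} {γ₀ : ℝ → ℂ} (hγ₀ : Continuous γ₀) {θ : ℝ → ℝ}
    (hθ : StrictMono θ) (hθs : Function.Surjective θ)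
    (hcont : ∀ a b, a ≤ b → HasMinkowskiContent d (γ₀ '' Icc a b) (ENNReal.ofReal (θ b - θ a)))
    (u₀ : ℝ) :
    ∃ τ : ℝ ≃o ℝ, τ 0 = u₀ ∧ (∀ t, θ (τ t) = t + θ u₀) ∧
      IsNaturallyParametrized d (γ₀ ∘ τ) ∧ Continuous (γ₀ ∘ τ) := by
  set Θ : ℝ ≃o ℝ := hθ.orderIsoOfSurjective θ hθs with hΘ
  have hθτ : ∀ t, θ (((OrderIso.addRight (θ u₀)).trans Θ.symm) t) = t + θ u₀ := fun t ↦ by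
    rw [OrderIso.trans_apply, OrderIso.addRight_apply]
    exact hθ.orderIsoOfSurjective_self_symm_apply θ hθs _
  refine ⟨(OrderIso.addRight (θ u₀)).trans Θ.symm, ?_, hθτ, ?_, ?_⟩
  · rw [OrderIso.trans_apply, OrderIso.addRight_apply, zero_add]
    exact hθ.orderIsoOfSurjective_symm_apply_self θ hθs u₀
  · intro a b hab
    set τ : ℝ ≃o ℝ := (OrderIso.addRight (θ u₀)).trans Θ.symm with hτ
    have himage : (γ₀ ∘ τ) '' Icc a b = γ₀ '' Icc (τ a) (τ b) := by
      rw [image_comp, τ.image_Icc]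
    have h := hcont (τ a) (τ b) (τ.monotone hab)
    rw [hθτ a, hθτ b, show b + θ u₀ - (a + θ u₀) = b - a by ring] at h
    rwa [himage]
  · exact hγ₀.comp (OrderIso.continuous _)

end TimeChange

section Concat

/-- **Concatenation of the two arms into one two-sided curve.** Let `η₁ : ℝ → ℂ` be a continuous arm
running towards its tip `lim_{t → +∞} η₁(t) = η₂(0)` and `η₂ : ℝ≥0 → ℂ` a continuous arm starting
there. Then `γ₀(u) = η₂(u)` for `u ≥ 0`, `γ₀(u) = η₁(-log(-u))` for `u < 0` is a continuous curve
`ℝ → ℂ` with `γ₀|[0, ∞) = η₂`, `γ₀|(-∞, 0) = η₁ ∘ φ₁` for the order isomorphism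
`φ₁ = -log(-·) : (-∞, 0) ≃o ℝ`, and trace `γ₀(ℝ) = η₁(ℝ) ∪ η₂(ℝ≥0)` (Zhan (2021), §2.1: the
concatenation `β ⊕ γ` "modulo a time change"). [cite: Zhan2021SLELoopMeasures, §2.1] -/
theorem exists_twoSidedConcat {η₁ : ℝ → ℂ} {η₂ : ℝ≥0 → ℂ} (h₁ : Continuous η₁) (h₂ : Continuous η₂)
    (hlim : Tendsto η₁ atTop (𝓝 (η₂ 0))) :
    ∃ γ₀ : ℝ → ℂ, Continuous γ₀ ∧ (∀ t : ℝ≥0, γ₀ t = η₂ t) ∧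
      (∃ φ₁ : Iio (0 : ℝ) ≃o ℝ, ∀ u : Iio (0 : ℝ), γ₀ u = η₁ (φ₁ u)) ∧
      range γ₀ = range η₁ ∪ range η₂ := by
  classical
  -- the concatenated curve
  set γ₀ : ℝ → ℂ := fun u ↦ if 0 ≤ u then η₂ u.toNNReal else η₁ (-Real.log (-u)) with hγ₀
  have hpos : ∀ u : ℝ, 0 ≤ u → γ₀ u = η₂ u.toNNReal := fun u hu ↦ by simp [hγ₀, hu]
  have hneg : ∀ u : ℝ, u < 0 → γ₀ u = η₁ (-Real.log (-u)) := fun u hu ↦ by simp [hγ₀, not_le.2 hu]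
  have hzero : γ₀ 0 = η₂ 0 := by rw [hpos 0 le_rfl, Real.toNNReal_zero]
  -- the backward time change `φ₁ = -log(-·) : (-∞, 0) ≃o ℝ`
  have hmono : StrictMono fun u : Iio (0 : ℝ) ↦ -Real.log (-(u : ℝ)) := by
    intro u v huv
    have hv : (v : ℝ) < 0 := v.2
    exact neg_lt_neg (Real.log_lt_log (neg_pos.2 hv) (neg_lt_neg huv))
  have hsurj : Function.Surjective fun u : Iio (0 : ℝ) ↦ -Real.log (-(u : ℝ)) := by
    intro t
    refine ⟨⟨-Real.exp (-t), ?_⟩, ?_⟩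
    · exact neg_lt_zero.2 (Real.exp_pos _)
    · simp only [neg_neg, Real.log_exp]
  -- continuity of the right branch everywhere and of the left branch off `0`
  have hright : Continuous fun u : ℝ ↦ η₂ u.toNNReal := h₂.comp continuous_real_toNNReal
  have hleft : ∀ u : ℝ, u ≠ 0 → ContinuousAt (fun u : ℝ ↦ η₁ (-Real.log (-u))) u := fun u hu ↦
    h₁.continuousAt.comp
      ((Real.continuousAt_log (neg_ne_zero.2 hu)).comp continuous_neg.continuousAt).neg
  -- the left branch tends to the tip as `u ↑ 0`
  have hlim' : Tendsto (fun u : ℝ ↦ η₁ (-Real.log (-u))) (𝓝[<] 0) (𝓝 (η₂ 0)) := by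
    have h1 : Tendsto (fun u : ℝ ↦ -u) (𝓝[<] (0 : ℝ)) (𝓝[>] (0 : ℝ)) := by
      rw [tendsto_nhdsWithin_iff]
      refine ⟨?_, ?_⟩
      · have : Tendsto (fun u : ℝ ↦ -u) (𝓝 (0 : ℝ)) (𝓝 (0 : ℝ)) := by
          simpa using (continuous_neg.tendsto (0 : ℝ))
        exact this.mono_left nhdsWithin_le_nhds
      · filter_upwards [self_mem_nhdsWithin] with u hu
        exact neg_pos.2 (show u < 0 from hu)
    exact hlim.comp (tendsto_neg_atBot_atTop.comp (Real.tendsto_log_nhdsGT_zero.comp h1))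
  have hcont : Continuous γ₀ := by
    rw [continuous_iff_continuousAt]
    intro u
    rcases lt_trichotomy u 0 with hu | rfl | hu
    · have heq : (fun u : ℝ ↦ η₁ (-Real.log (-u))) =ᶠ[𝓝 u] γ₀ := by
        filter_upwards [Iio_mem_nhds hu] with v hv
        exact (hneg v hv).symm
      exact (hleft u hu.ne).congr heq
    · rw [continuousAt_iff_continuous_left'_right']
      refine ⟨?_, ?_⟩
      · have heq : (fun u : ℝ ↦ η₁ (-Real.log (-u))) =ᶠ[𝓝[<] (0 : ℝ)] γ₀ := by
          filter_upwards [self_mem_nhdsWithin] with v hv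
          exact (hneg v hv).symm
        rw [ContinuousWithinAt, hzero]
        exact hlim'.congr' heq
      · have heq : (fun u : ℝ ↦ η₂ u.toNNReal) =ᶠ[𝓝[>] (0 : ℝ)] γ₀ := by
          filter_upwards [self_mem_nhdsWithin] with v hv
          exact (hpos v (le_of_lt hv)).symm
        rw [ContinuousWithinAt, hzero]
        have h0 : Tendsto (fun u : ℝ ↦ η₂ u.toNNReal) (𝓝 (0 : ℝ)) (𝓝 (η₂ 0)) := by
          simpa using hright.tendsto (0 : ℝ)
        exact (h0.mono_left nhdsWithin_le_nhds).congr' heq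
    · have heq : (fun u : ℝ ↦ η₂ u.toNNReal) =ᶠ[𝓝 u] γ₀ := by
        filter_upwards [Ioi_mem_nhds hu] with v hv
        exact (hpos v (le_of_lt hv)).symm
      exact hright.continuousAt.congr heq
  refine ⟨γ₀, hcont, fun t ↦ ?_, ⟨hmono.orderIsoOfSurjective _ hsurj, fun u ↦ ?_⟩, ?_⟩
  · rw [hpos t t.2, Real.toNNReal_coe]
  · rw [StrictMono.coe_orderIsoOfSurjective]
    exact hneg u u.2
  · apply Subset.antisymm
    · rintro _ ⟨u, rfl⟩
      rcases le_or_gt 0 u with hu | hu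
      · rw [hpos u hu]; exact Or.inr (mem_range_self _)
      · rw [hneg u hu]; exact Or.inl (mem_range_self _)
    · rintro z (⟨s, rfl⟩ | ⟨t, rfl⟩)
      · refine ⟨-Real.exp (-s), ?_⟩
        rw [hneg _ (neg_lt_zero.2 (Real.exp_pos _)), neg_neg, Real.log_exp, neg_neg]
      · exact ⟨t, by rw [hpos t t.2, Real.toNNReal_coe]⟩

end Concat

section Arms

/-- **The natural parametrisation of a two-sided curve, rooted at the junction of its arms**
(Zhan (2021), Rem. 2.4 and the space `Γ` of Cor. 4.7: "there is a unique Minkowski content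
parametrization of `γ`, denoted by `𝒫(γ)`, such that `𝒫(γ)(0) = 0`" — here its existence). Let
`γ₀ : ℝ → ℂ` be a continuous two-sided curve tracing the arm `η₂` on `[0, ∞)` and the arm `η₁` on
`(-∞, 0)` through increasing time changes (onto `ℝ≥0`, resp. onto `ℝ`), with `η₂(0) = 0`, and suppose
its arcs have `d`-dimensional Minkowski content `Cont_d(γ₀[a, b]) = θ(b) - θ(a)` for a strictly
increasing time change `θ` of `ℝ` ONTO `ℝ` (parametrizable content with definition interval `ℝ`).
Then there is a two-sided path `γ̂ : C(ℝ, ℂ)` parametrised by `d`-dimensional Minkowski content,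
rooted at `γ̂(0) = 0`, tracing `η₂` on `[0, ∞)` and `η₁` on `(-∞, 0)` through increasing time changes
— the almost-sure clauses of `IsTwoSidedWholePlaneSLENatLaw`.
[cite: Zhan2021SLELoopMeasures, Rem. 2.4 / Cor. 4.7] -/
theorem exists_natParam_of_arms {d : ℝ} {γ₀ : ℝ → ℂ} {η₁ : ℝ → ℂ} {η₂ : ℝ≥0 → ℂ}
    (hγ₀ : Continuous γ₀) (h₂ : ∃ φ₂ : ℝ≥0 ≃o ℝ≥0, ∀ t : ℝ≥0, γ₀ t = η₂ (φ₂ t))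
    (h₁ : ∃ φ₁ : Iio (0 : ℝ) ≃o ℝ, ∀ u : Iio (0 : ℝ), γ₀ u = η₁ (φ₁ u)) (h0 : η₂ 0 = 0)
    {θ : ℝ → ℝ} (hθ : StrictMono θ) (hθs : Function.Surjective θ)
    (hcont : ∀ a b, a ≤ b → HasMinkowskiContent d (γ₀ '' Icc a b) (ENNReal.ofReal (θ b - θ a))) :
    ∃ γ : C(ℝ, ℂ), IsNaturallyParametrized d γ ∧ γ 0 = 0 ∧
      (∃ e : ℝ≥0 ≃o ℝ≥0, ∀ t : ℝ≥0, γ t = η₂ (e t)) ∧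
      (∃ e' : Iio (0 : ℝ) ≃o ℝ, ∀ t : Iio (0 : ℝ), γ t = η₁ (e' t)) := by
  obtain ⟨τ, hτ0, -, hnat, hcont'⟩ := exists_natParam_of_timeChange hγ₀ hθ hθs hcont 0
  obtain ⟨φ₁, hφ₁⟩ := h₁
  obtain ⟨φ₂, hφ₂⟩ := h₂
  -- `τ` maps `[0, ∞)` onto `[0, ∞)` and `(-∞, 0)` onto `(-∞, 0)`
  have hτnn : ∀ t : ℝ≥0, 0 ≤ τ t := fun t ↦ by simpa [hτ0] using τ.monotone t.2
  have hτsymm : ∀ u : ℝ≥0, 0 ≤ τ.symm u := fun u ↦ by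
    have h : τ 0 ≤ (u : ℝ) := by rw [hτ0]; exact u.2
    simpa using τ.symm.monotone h
  have hτneg : ∀ t : Iio (0 : ℝ), τ t < 0 := fun t ↦ by simpa [hτ0] using τ.strictMono t.2
  have hτsymm' : ∀ u : Iio (0 : ℝ), τ.symm u < 0 := fun u ↦ by
    have h : (u : ℝ) < τ 0 := by rw [hτ0]; exact u.2
    simpa using τ.symm.strictMono h
  let e : ℝ≥0 ≃o ℝ≥0 :=
    { toFun := fun t ↦ NNReal.mk (τ t) (hτnn t)
      invFun := fun u ↦ NNReal.mk (τ.symm u) (hτsymm u)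
      left_inv := fun t ↦ NNReal.eq (by
        simp only [NNReal.coe_mk, OrderIso.symm_apply_apply])
      right_inv := fun u ↦ NNReal.eq (by
        simp only [NNReal.coe_mk, OrderIso.apply_symm_apply])
      map_rel_iff' := fun {a b} ↦ by
        show NNReal.mk (τ a) (hτnn a) ≤ NNReal.mk (τ b) (hτnn b) ↔ a ≤ b
        simp only [← NNReal.coe_le_coe, NNReal.coe_mk, OrderIso.le_iff_le] }
  let e₀ : Iio (0 : ℝ) ≃o Iio (0 : ℝ) :=
    { toFun := fun t ↦ ⟨τ t, hτneg t⟩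
      invFun := fun u ↦ ⟨τ.symm u, hτsymm' u⟩
      left_inv := fun t ↦ Subtype.ext (by
        simp only [OrderIso.symm_apply_apply])
      right_inv := fun u ↦ Subtype.ext (by
        simp only [OrderIso.apply_symm_apply])
      map_rel_iff' := fun {a b} ↦ by
        show (⟨τ a, hτneg a⟩ : Iio (0 : ℝ)) ≤ ⟨τ b, hτneg b⟩ ↔ a ≤ b
        simp only [Subtype.mk_le_mk, OrderIso.le_iff_le, Subtype.coe_le_coe] }
  have he : ∀ t : ℝ≥0, ((e t : ℝ≥0) : ℝ) = τ t := fun t ↦ rfl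
  have he₀ : ∀ t : Iio (0 : ℝ), ((e₀ t : Iio (0 : ℝ)) : ℝ) = τ t := fun t ↦ rfl
  refine ⟨⟨γ₀ ∘ τ, hcont'⟩, hnat, ?_, ⟨e.trans φ₂, fun t ↦ ?_⟩, ⟨e₀.trans φ₁, fun t ↦ ?_⟩⟩
  · have hφ0 : φ₂ 0 = 0 := by simpa using φ₂.map_bot
    show γ₀ (τ 0) = 0
    rw [hτ0, ← NNReal.coe_zero, hφ₂ 0, hφ0, h0]
  · show γ₀ (τ t) = η₂ (φ₂ (e t))
    rw [← he t, hφ₂]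
  · show γ₀ (τ t) = η₁ (φ₁ (e₀ t))
    rw [← he₀ t]
    exact hφ₁ (e₀ t)

end Arms

section FirstArm

variable {Ω Ω' : Type*} [MeasurableSpace Ω] [MeasurableSpace Ω']

/-- **Transport of the first arm.** A whole-plane SLE_κ(ρ) curve `γ` on `(Ω, P)` pulled back along a
measurable map `f : Ω' → Ω` with `P' ∘ f⁻¹ = P` is a whole-plane SLE_κ(ρ) curve on `(Ω', P')`: the
driving data `(X ∘ f, q₀ ∘ f)` have the same laws and are again independent, and the almost-sure
generation of the whole-plane Loewner chain by the curve transports along `f`. (Used to place the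
first arm of the two-sided curve and an independent Brownian path on ONE probability space.)
[folklore] -/
theorem IsWholePlaneSLEKappaRho.comp_of_map_eq {κ : ℝ≥0} {ρ : ℝ} {P : Measure Ω}
    {γ : Ω → ℝ → ℂ} (h : IsWholePlaneSLEKappaRho κ ρ P γ) {P' : Measure Ω'} {f : Ω' → Ω}
    (hf : Measurable f) (hmap : P'.map f = P) : IsWholePlaneSLEKappaRho κ ρ P' (γ ∘ f) := by
  obtain ⟨hmeas, X, q₀, hX, hq₀, hlaw, hunif, hind, hae⟩ := h
  refine ⟨fun t ↦ (hmeas t).comp hf, X ∘ f, q₀ ∘ f, hX.comp hf, hq₀.comp hf, ?_, ?_, ?_, ?_⟩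
  · rw [← Measure.map_map hX hf, hmap]
    exact hlaw
  · rw [← Measure.map_map hq₀ hf, hmap]
    exact hunif
  · rw [indepFun_iff_measure_inter_preimage_eq_mul] at hind ⊢
    intro s t hs ht
    have h1 := hind s t hs ht
    rw [← hmap, Measure.map_apply hf (hX hs), Measure.map_apply hf (hq₀ ht),
      Measure.map_apply hf ((hX hs).inter (hq₀ ht))] at h1
    exact h1
  · have hae' : ∀ᵐ ω ∂(P'.map f),
        ∃ C : WholePlaneLoewnerChain (drivingOfAngle (q₀ ω) (X ω)), C.IsCurve (γ ω) := by
      rw [hmap]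
      exact hae
    exact ae_of_ae_map hf.aemeasurable hae'

/-- **The first arm on a product space**: if `γ` is a whole-plane SLE_κ(ρ) curve on `(Ω, P)` and `Q`
is a probability measure on `Ω'` (e.g. the Wiener law of the driving path of the second arm), then
`γ ∘ Prod.fst` is a whole-plane SLE_κ(ρ) curve on `(Ω × Ω', P ⊗ Q)` (and it is independent of every
random variable factoring through `Prod.snd`, Mathlib's `indepFun_prod`). [folklore] -/
theorem IsWholePlaneSLEKappaRho.comp_fst {κ : ℝ≥0} {ρ : ℝ} {P : Measure Ω} {γ : Ω → ℝ → ℂ}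
    (h : IsWholePlaneSLEKappaRho κ ρ P γ) (Q : Measure Ω') [IsProbabilityMeasure Q] :
    IsWholePlaneSLEKappaRho κ ρ (P.prod Q) (γ ∘ Prod.fst) := by
  haveI := h.isProbabilityMeasure
  exact h.comp_of_map_eq measurable_fst (by rw [Measure.map_fst_prod, measure_univ, one_smul])

end FirstArm

end Literature.Probability.RandomPlanarGeometry
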